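import Literature.AlgebraicGeometry.ShimuraVarieties.UnitaryShimuraCurveSpecialPointComponents
import Literature.AlgebraicGeometry.Motives.BaseChangeTowerCofan
import Literature.AlgebraicGeometry.Motives.BaseChangePointsOfTower
import HarnessLib

/-!
# Every connected component of the τE-thickened complex curve `((M_K) ⊗_L Fᵢ) ⊗_{Fᵢ,τE} ℂ` contains a special (CM) point — (G1) moved along the
# tower isomorphism (Σ-GAL input ◻ H0 of [A-p09 (g22) HANDOFF-E6γ]; [Deligne 1979] 2.1.2–2.1.3, [Milne 2005] Lemma 13.5)

Topic `AlgebraicGeometry/ShimuraVarieties`; namespace `Literature.AlgebraicGeometry.ShimuraVarieties.UnitaryCanonicalModel.RecordSystemGS`.  THEOREMS ONLY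
(no definition, no named fact, no instance, no notation, no `sorry`).  Sequel of ★ (G1) `UnitaryShimuraCurveSpecialPointComponents` (A-p09 (g22)) over ★ COV-1
`Motives/BaseChangeTowerCofan` (A-p04 (g24)).  Cell `hodgecm-mathlib` (D-0151), FLOOR 0, P6 «MOD» (crux hLiu418 = stmt-HodgeConjecture-24832, `--supports`), E6
closer of `Cruxes/HLiu418/Lines/F0_P6a_PELWitnessE.lean`, socket Σ-GAL `ReadsCReading → ReadsCGalois` (A-p09 lineage): recipe step 2 of the (G3) assembler —
«field point: ★ G1 (ι₁-model); move to `X_ℂ = ((S.M Kc) ⊗ Fᵢ) ⊗_{τE} ℂ` by the tower iso `hτE` — ◻ H0, small» — is this file.  HC_CM is proved only modulo the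
printed citations (2 remaining named inputs hLiu418 24832, h413 24833) until rung 0 closes; this file is count-neutral.

THE MATHEMATICS.  ★ (G1): every connected component of `(M_K)_τ := (baseChangeHom τ).obj (S.M K)` contains a special point `[τw, aK]`, `w ∈ L²`
([Deligne1979ShimuraVarieties] 2.1.2–2.1.3: the pieces `Γ_q∖𝔻` are connected and uniformised by `v ↦ [v, g_q K]`; special vectors are dense).  The E6
closer's complex curve is the ITERATED base change `Xc := ((S.M K) ⊗_L Fᵢ) ⊗_{Fᵢ,τE} ℂ` with `τE ∘ (L → Fᵢ) = τ`; ★ COV-1 `exists_towerIso_of_comp_eq` gives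
`e : Xc ≅ (M_K)_τ` over `Spec ℂ` commuting with the projections, and an isomorphism of schemes is a homeomorphism, so it carries connected components to
connected components (§1).  Hence (§2) every connected component of `Xc` contains an HONEST complex point `P` (a section over `Spec ℂ`) whose image in
`M_K` is the special point `[τw, aK]` — read as `P.left ≫ pr_{Fᵢ→ℂ} ≫ pr_{L→Fᵢ} = ((S.pts K)⁻¹ [τw, aK]).left`, the `Pflat` relation of the closer's `ReadsC`
clauses, and as `P.left.base (closed point) ∈ connectedComponent x`, the field-point shape of ★ B-γ `forall_gal_comp_eq_of_forall_exists_fieldPoint`.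

* §1 `mem_connectedComponent_of_iso` — points move between connected components along an isomorphism of schemes (plumbing, private).
* §2 **`exists_specialPoint_pt_mem_connectedComponent_tower`** — THE HEAD.

## References
* [Deligne1979ShimuraVarieties] P. Deligne, *Variétés de Shimura* (1979), 2.1.2–2.1.3.
* [Milne2005ShimuraVarieties] J. S. Milne, *Introduction to Shimura varieties* (2005), §5 Lemma 5.13 p. 57, §13 Lemma 13.5 p. 118.
* [GortzWedhorn2020] U. Görtz, T. Wedhorn, *Algebraic Geometry I*, 2nd ed. (2020), Prop. 4.16 (p. 101), Section (4.7).
-/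

set_option autoImplicit false

noncomputable section

open Matrix NumberField CategoryTheory CategoryTheory.Limits AlgebraicGeometry Topology
open Literature.NumberTheory.Automorphic.Liu2021.AppendixC (C5.OpenCompactSubgroup C5.SmallLevel)
open Literature.NumberTheory.Automorphic.UnitaryGroup (finAdelic rational rationalToFinAdelic arithmeticLevel)
open Literature.AlgebraicGeometry.Motives (ComplexPoints AlgPoints SchemeOver baseChange baseChangeHom)

namespace Literature.AlgebraicGeometry.ShimuraVarieties.UnitaryCanonicalModel

variable {L : Type} [Field L] [NumberField L] [IsCMField L] {Jstar : Matrix (Fin 2) (Fin 2) L} {τ : L →+* ℂ}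
  {K₀ : C5.OpenCompactSubgroup ↥(finAdelic (↥(maximalRealSubfield L)) L (IsCMField.complexConj L) 2 Jstar)}

namespace RecordSystemGS

/-! ### §1 Connected components along an isomorphism of schemes -/

/-- Along an isomorphism `e : X ≅ Y` of schemes over a base, a point `y` in the connected component of `e.hom x` is carried by `e.inv` into the
connected component of `x` (continuous images of connected sets are connected). [folklore] -/
private theorem mem_connectedComponent_of_iso {B : Scheme.{0}} {X Y : Over B} (e : X ≅ Y) (x : ↥X.left) {y : ↥Y.left}
    (hy : y ∈ connectedComponent (e.hom.left.base x)) : e.inv.left.base y ∈ connectedComponent x := by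
  have hx : e.inv.left.base (e.hom.left.base x) = x := by
    change (e.hom.left ≫ e.inv.left).base x = x
    rw [← Over.comp_left, e.hom_inv_id, Over.id_left, Scheme.Hom.id_base]
    rfl
  have hpre : _root_.IsPreconnected (e.inv.left.base '' connectedComponent (e.hom.left.base x)) :=
    isPreconnected_connectedComponent.image _ e.inv.left.base.hom.continuous.continuousOn
  have hsub := hpre.subset_connectedComponent (x := x) ⟨e.hom.left.base x, mem_connectedComponent, hx⟩
  exact hsub ⟨y, hy, rfl⟩

/-! ### §2 The head -/

set_option maxHeartbeats 400000 in
/-- **Every connected component of the τE-thickened complex curve `Xc = ((M_K) ⊗_L Fᵢ) ⊗_{Fᵢ,τE} ℂ` contains a special point** — ★ (G1)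
`exists_specialPoint_pt_mem_connectedComponent` moved along the tower isomorphism ★ `exists_towerIso_of_comp_eq` (`τE ∘ (L → Fᵢ) = τ`): for every
point `x` of `Xc` there are `w ∈ L²` with `τw` in the negative cone, an adelic `a`, and an HONEST complex point `P` of `Xc` (a morphism over `Spec ℂ`) with
`P`'s underlying point in the connected component of `x` and `P.left ≫ pr ≫ pr = ((S.pts K)⁻¹ [τw, aK]).left` — the special point `[τw, aK]` of `M_K` read
FLAT, as the `ReadsC` clauses of the E6 closer and ★ B-γ `forall_gal_comp_eq_of_forall_exists_fieldPoint` consume it.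
[cite: Deligne1979ShimuraVarieties, 2.1.2–2.1.3] [cite: Milne2005ShimuraVarieties, §13 Lemma 13.5 p. 118] [cite: GortzWedhorn2020, Prop. 4.16 (p. 101)] -/
theorem exists_specialPoint_pt_mem_connectedComponent_tower (S : RecordSystemGS L Jstar τ K₀) (K : C5.SmallLevel K₀)
    {Fi : Type} [Field Fi] [Algebra L Fi] (τE : Fi →+* ℂ) (hτE : τE.comp (algebraMap L Fi) = τ)
    (x : letI : Algebra Fi ℂ := τE.toAlgebra; ↥((baseChange Fi ℂ).obj ((baseChange L Fi).obj (S.M.obj K))).left) :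
    letI : Algebra Fi ℂ := τE.toAlgebra
    letI : Algebra L ℂ := τ.toAlgebra
    ∃ (w : Fin 2 → L) (hw : (fun i => τ (w i)) ∈ negCone (Jstar.map τ))
      (a : ↥(finAdelic (↥(maximalRealSubfield L)) L (IsCMField.complexConj L) 2 Jstar))
      (P : ComplexPoints ((baseChange Fi ℂ).obj ((baseChange L Fi).obj (S.M.obj K)))),
      P.pt ∈ connectedComponent x ∧
      P.left.base (IsLocalRing.closedPoint ℂ) ∈ connectedComponent x ∧
      P.left ≫ pullback.fst ((baseChange L Fi).obj (S.M.obj K)).hom (Motives.AbelianVariety.bcSpec Fi ℂ) ≫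
          pullback.fst (S.M.obj K).hom (Motives.AbelianVariety.bcSpec L Fi) =
        ((S.pts K).symm (ShimuraSetGS.mk L Jstar τ K.1.1 (fun i => τ (w i)) hw a)).left := by
  letI : Algebra Fi ℂ := τE.toAlgebra
  letI : Algebra L ℂ := τ.toAlgebra
  -- the tower isomorphism `e : Xc ≅ (M_K)_τ` over `Spec ℂ` (★ COV-1)
  obtain ⟨e, -, hinv⟩ := Motives.exists_towerIso_of_comp_eq (k := L) (K := Fi) (L := ℂ) τE τ hτE (S.M.obj K)
  -- (G1) at the point `e x` of `(M_K)_τ`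
  obtain ⟨w, hw, a, hmem⟩ := S.exists_specialPoint_pt_mem_connectedComponent K (e.hom.left.base x)
  set P₁ := AlgPoints.baseChangeEquiv τ (S.M.obj K) ((S.pts K).symm (ShimuraSetGS.mk L Jstar τ K.1.1 (fun i => τ (w i)) hw a))
    with hP₁
  refine ⟨w, hw, a, AlgPoints.map e.inv P₁, ?_, ?_, ?_⟩
  · -- the underlying point moves along `e⁻¹` into the component of `x`
    rw [AlgPoints.pt_map]
    exact mem_connectedComponent_of_iso e x hmem
  · -- `P.left.base (closed point)` IS `P.pt` (Mathlib `Scheme.SpecToEquivOfField`, by `rfl`)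
    change (AlgPoints.map e.inv P₁).pt ∈ connectedComponent x
    rw [AlgPoints.pt_map]
    exact mem_connectedComponent_of_iso e x hmem
  · -- the flat reading: `P.left ≫ pr ≫ pr = e⁻¹ ≫ pr ≫ pr = π_τ`, then `baseChangeEquiv` lies over its argument
    change (P₁.left ≫ e.inv.left) ≫ _ ≫ _ = _
    rw [Category.assoc, hinv]
    exact AlgPoints.baseChangeEquiv_apply_left_comp_fst τ (S.M.obj K) _

end RecordSystemGS

end Literature.AlgebraicGeometry.ShimuraVarieties.UnitaryCanonicalModel

end
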